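import Mathlib
import Summits.KontsevichZagierPeriods.Zeta5Search.ThirdDigitVTransport
import Summits.KontsevichZagierPeriods.Zeta5Search.HarmonicWolstenholme
import Summits.KontsevichZagierPeriods.Zeta5Search.SecondDigitVProof
import HarnessLib

/-!
# ζ(5) search — the CLASSWISE THIRD-DIGIT LEMMA for `V_x` is a THEOREM (gen-2 g10's (V3), `ThirdDigitV`)

Cell `pub-zeta5` (HONEST FRAMING: systematic search; no irrationality claim unless certified), typer seat generation 12.
Discharges BY NAME `SecondOrder.ThirdDigitV` of `Zeta5Search/ThirdOrderDigit.lean` (gen-2 g10, REPORT-gen2-g10 §6.2 (V3), exact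
check 273,137 classes with `E ≤ −3`): for a residue class with base `x < p` and `E_x ≤ −3` (window `5 ≤ p`, `b₀ + 2 < p²`),
**`v_p( V_x − (−p)^{E_x} ĝ_x (v̂_x − pφ_x v̂₂_x + p²c_x v̂₃_x) ) ≥ E_x + 3`**.
Proof (REPORT §6.2): split `H_s^{(σ)} = p^{−σ}H^{(σ)}_{ℓ_s} + N_{s,σ}`.  The level part carries the third-order digit of `c_{σ−1,s}`
(`leadingDigit₃`, units moved to the base by `thirdOrder_transport_bound`).  In the `N`-part the orders `σ = 1, 2` survive modulo
`p^{E+3}`: `N_{s,1} ≡ H_x − ℓ_s pH^{(2)}_x (mod p²)` (Wolstenholme, `padicNorm_harmN1_sub_le₂`) and `N_{s,2} ≡ H^{(2)}_x (mod p)`; the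
resulting corrections `(−p)^{E+1}ĝ_x[H_xΣρ₁ − pφ_xH_xΣ(ℓρ₁+ρ₂) − pH^{(2)}_xΣℓρ₁]` and `(−p)^{E+2}ĝ_xH^{(2)}_xΣρ₂` CANCEL by the residue
identities `Σρ₁ = 0`, `Σ(ℓρ₁ + ρ₂) = 0` (`rhoResidueIdentities_holds`, `E ≤ −3`).  `p`-adic valuations of rational numbers; nothing here concerns
irrationality.
-/

noncomputable section

open Finset PowerSeries

namespace Summit.KontsevichZagierPeriods.Zeta5Search.SecondOrder

open Summit.KontsevichZagierPeriods.Zeta5Search.DualSeries (InBox)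
open Summit.KontsevichZagierPeriods.Zeta5Search.WedgeDictionary (pfData)
open Summit.KontsevichZagierPeriods.Zeta5Search.CasoratianValuation (InPolytope)
open Summit.KontsevichZagierPeriods.Zeta5Search.ClusterValuation
open Summit.KontsevichZagierPeriods.Zeta5Search.PadicSeries
open Summit.KontsevichZagierPeriods.Zeta5Search.CellA (padicNorm_classRho_le_one pfData_eq_zero_of_order_le gHat_classCongr
  padicNorm_pow_eq padicNorm_mul_sub_mul_le padicNorm_p padicNorm_inv_sub_inv_le padicNorm_harm_sub_level_le_one harm_succ
  sum_Icc_one_eq_sum_range_six padicNorm_harm_le_one padicNorm_p_pow)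
open Summit.KontsevichZagierPeriods.Zeta5Search.BigPrime (padicNorm_mul_le_one)
open Literature.NumberTheory.Transcendental.BallRivoal (harm)

variable {p : ℕ} [hp : Fact p.Prime]

/-! ### (V3) -/

/-- **(V3) — the classwise third digit of `V_x` (gen-2 g10's `ThirdDigitV`) is a theorem.** -/
theorem thirdDigitV_holds : ThirdDigitV := by
  intro b p x hb hprime hp5 hwin hx hpole hE3 hne
  haveI : Fact p.Prime := ⟨hprime⟩
  obtain ⟨hbox, -, -, hn⟩ := thmA_data b hb hwin
  have h0 : 0 ≤ b 0 := hbox.1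
  have hp2 : p ≠ 2 := by omega
  have hp0 : (p : ℚ) ≠ 0 := Nat.cast_ne_zero.2 hprime.ne_zero
  have hp' : (-(p : ℚ)) ≠ 0 := neg_ne_zero.2 hp0
  have hxmem : x ∈ classSet b p x := base_mem_classSet b hx hpole
  set E := classExp b p x with hE
  set g := gHat b p x with hg
  set φ := phiHat b p x with hφ
  set cc := curvHat b p x with hcc
  set Hx := harm 1 x with hHx
  set Hx2 := harm 2 x with hHx2
  -- the model summands
  set F1 : ℕ → ℕ → ℚ := fun s σ => (-1 : ℚ) ^ σ * classRho b p s σ * harm σ (s / p) with hF1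
  set F2 : ℕ → ℕ → ℚ := fun s σ => (-1 : ℚ) ^ σ * (((s / p : ℕ) : ℚ) * classRho b p s σ
      + (if (σ : ℤ) + 1 ≤ -netExp b s then classRho b p s (σ + 1) else 0)) * harm σ (s / p) with hF2
  set F3 : ℕ → ℕ → ℚ := fun s σ => (-1 : ℚ) ^ σ * (((s / p : ℕ) : ℚ) ^ 2 * classRho b p s σ
      + (if (σ : ℤ) + 1 ≤ -netExp b s then 2 * ((s / p : ℕ) : ℚ) * classRho b p s (σ + 1) else 0)
      + (if (σ : ℤ) + 2 ≤ -netExp b s then classRho b p s (σ + 2) else 0)) * harm σ (s / p) with hF3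
  -- v̂, v̂₂, v̂₃ as double sums over the whole class and `o < 6`
  have h6 : ∀ s, (-netExp b s).toNat ≤ 6 := fun s => by
    have := blockCount_le b s; unfold netExp; split_ifs <;> omega
  have hIcc : ∀ (F : ℕ → ℕ → ℚ) s, (∑ σ ∈ Icc 1 (-netExp b s).toNat, F s σ) =
      ∑ o ∈ range 6, (if (o : ℤ) + 1 ≤ -netExp b s then F s (o + 1) else 0) := by
    intro F s
    rw [sum_Icc_one_eq_sum_range_six (h6 s)]
    refine sum_congr rfl fun o _ => ?_
    have : (o + 1 ≤ (-netExp b s).toNat) ↔ ((o : ℤ) + 1 ≤ -netExp b s) := by omega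
    simp only [this]
  have hpoles : ∀ (F : ℕ → ℕ → ℚ), (∑ s ∈ classPoles b p x, ∑ σ ∈ Icc 1 (-netExp b s).toNat, F s σ) =
      ∑ s ∈ classSet b p x, ∑ o ∈ range 6, (if (o : ℤ) + 1 ≤ -netExp b s then F s (o + 1) else 0) := by
    intro F
    rw [classPoles, sum_filter]
    refine sum_congr rfl fun s _ => ?_
    split_ifs with hpole'
    · exact hIcc F s
    · refine (sum_eq_zero fun o _ => ?_).symm
      rw [if_neg (by omega)]
  have hv : vHat b p x = ∑ s ∈ classSet b p x, ∑ o ∈ range 6,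
      (if (o : ℤ) + 1 ≤ -netExp b s then F1 s (o + 1) else 0) := by
    rw [vHat]; exact hpoles F1
  have hv2 : vHat2 b p x = ∑ s ∈ classSet b p x, ∑ o ∈ range 6,
      (if (o : ℤ) + 1 ≤ -netExp b s then F2 s (o + 1) else 0) := by
    rw [vHat2]; exact hpoles F2
  have hv3 : vHat3 b p x = ∑ s ∈ classSet b p x, ∑ o ∈ range 6,
      (if (o : ℤ) + 1 ≤ -netExp b s then F3 s (o + 1) else 0) := by
    rw [vHat3]; exact hpoles F3
  -- the termwise model and the corrections at σ = 1, 2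
  set A : ℕ → ℕ → ℚ := fun s o => pfData b o s * harm (o + 1) s - (-(p : ℚ)) ^ E * g *
      ((if (o : ℤ) + 1 ≤ -netExp b s then F1 s (o + 1) else 0)
        - (p : ℚ) * φ * (if (o : ℤ) + 1 ≤ -netExp b s then F2 s (o + 1) else 0)
        + (p : ℚ) ^ 2 * cc * (if (o : ℤ) + 1 ≤ -netExp b s then F3 s (o + 1) else 0)) with hA
  set Cr : ℕ → ℕ → ℚ := fun s o =>
      (if o = 0 ∧ netExp b s < 0 then (-(p : ℚ)) ^ (E + 1) * g *
        (Hx * classRho b p s 1 - (p : ℚ) * φ * Hx * (((s / p : ℕ) : ℚ) * classRho b p s 1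
            + (if netExp b s ≤ -2 then classRho b p s 2 else 0))
          - (p : ℚ) * Hx2 * ((s / p : ℕ) : ℚ) * classRho b p s 1) else 0)
      + (if o = 1 ∧ netExp b s ≤ -2 then (-(p : ℚ)) ^ (E + 2) * g * Hx2 * classRho b p s 2 else 0) with hCr
  have hsplit : classV b p x - (-(p : ℚ)) ^ E * g * (vHat b p x - (p : ℚ) * φ * vHat2 b p x + (p : ℚ) ^ 2 * cc * vHat3 b p x) =
      ∑ s ∈ classSet b p x, ∑ o ∈ range 6, A s o := by
    rw [hv, hv2, hv3, classV, mul_sum, mul_sum, ← sum_sub_distrib, ← sum_add_distrib, mul_sum, ← sum_sub_distrib]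
    refine sum_congr rfl fun s _ => ?_
    rw [mul_sum, mul_sum, ← sum_sub_distrib, ← sum_add_distrib, mul_sum, ← sum_sub_distrib]
  -- the corrections sum to zero: `Σρ₁ = 0`, `Σ(ρ₂ + ℓρ₁) = 0` (E ≤ -3)
  have hR := rhoResidueIdentities_holds b p x hb hprime hp5 hwin hx
  have hres1 : ∑ s ∈ classPoles b p x, classRho b p s 1 = 0 := hR.1 (by omega)
  have hres2 : ∑ s ∈ classPoles b p x, ((if netExp b s ≤ -2 then classRho b p s 2 else 0)
      + ((s / p : ℕ) : ℚ) * classRho b p s 1) = 0 := hR.2.1 hE3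
  have hCsum : ∑ s ∈ classSet b p x, ∑ o ∈ range 6, Cr s o = 0 := by
    -- only `o = 0` and `o = 1` carry corrections
    have hinner : ∀ s, ∑ o ∈ range 6, Cr s o = Cr s 0 + Cr s 1 := by
      intro s
      rw [sum_range_succ', sum_range_succ']
      have hrest : ∑ o ∈ range 4, Cr s (o + 1 + 1) = 0 := sum_eq_zero fun o _ => by
        simp only [hCr, show o + 1 + 1 ≠ 0 by omega, show o + 1 + 1 ≠ 1 by omega, false_and, if_false, add_zero]
      rw [hrest, zero_add, add_comm]
    have hC0 : ∀ s, Cr s 0 = if netExp b s < 0 then (-(p : ℚ)) ^ (E + 1) * g *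
        (Hx * classRho b p s 1 - (p : ℚ) * φ * Hx * (((s / p : ℕ) : ℚ) * classRho b p s 1
            + (if netExp b s ≤ -2 then classRho b p s 2 else 0))
          - (p : ℚ) * Hx2 * ((s / p : ℕ) : ℚ) * classRho b p s 1) else 0 := by
      intro s; simp only [hCr, true_and, zero_ne_one, false_and, if_false, add_zero]
    have hC1 : ∀ s, Cr s 1 = if netExp b s < 0 then
        (-(p : ℚ)) ^ (E + 2) * g * Hx2 * (if netExp b s ≤ -2 then classRho b p s 2 else 0) else 0 := by
      intro s
      simp only [hCr, one_ne_zero, false_and, if_false, zero_add, true_and]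
      by_cases h2 : netExp b s ≤ -2
      · rw [if_pos h2, if_pos h2, if_pos (show netExp b s < 0 by omega)]
      · rw [if_neg h2, if_neg h2]; split_ifs <;> ring
    rw [sum_congr rfl fun s _ => by rw [hinner s, hC0 s, hC1 s], sum_add_distrib, ← sum_filter, ← sum_filter]
    change (∑ s ∈ classPoles b p x, _) + (∑ s ∈ classPoles b p x, _) = 0
    have e1 : ∑ s ∈ classPoles b p x, (-(p : ℚ)) ^ (E + 1) * g *
        (Hx * classRho b p s 1 - (p : ℚ) * φ * Hx * (((s / p : ℕ) : ℚ) * classRho b p s 1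
            + (if netExp b s ≤ -2 then classRho b p s 2 else 0))
          - (p : ℚ) * Hx2 * ((s / p : ℕ) : ℚ) * classRho b p s 1) =
        (-(p : ℚ)) ^ (E + 1) * g * (Hx * ∑ s ∈ classPoles b p x, classRho b p s 1
          - (p : ℚ) * φ * Hx * ∑ s ∈ classPoles b p x, ((if netExp b s ≤ -2 then classRho b p s 2 else 0)
              + ((s / p : ℕ) : ℚ) * classRho b p s 1)
          - (p : ℚ) * Hx2 * ∑ s ∈ classPoles b p x, ((s / p : ℕ) : ℚ) * classRho b p s 1) := by
      rw [mul_sum, mul_sum, mul_sum, ← sum_sub_distrib, ← sum_sub_distrib, mul_sum]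
      exact sum_congr rfl fun s _ => by ring
    have e2 : ∑ s ∈ classPoles b p x, (-(p : ℚ)) ^ (E + 2) * g * Hx2 * (if netExp b s ≤ -2 then classRho b p s 2 else 0) =
        (-(p : ℚ)) ^ (E + 2) * g * Hx2 * ∑ s ∈ classPoles b p x, (if netExp b s ≤ -2 then classRho b p s 2 else 0) := by
      rw [mul_sum]
    have e3 : ∑ s ∈ classPoles b p x, ((s / p : ℕ) : ℚ) * classRho b p s 1 =
        -∑ s ∈ classPoles b p x, (if netExp b s ≤ -2 then classRho b p s 2 else 0) := by
      rw [sum_add_distrib] at hres2; linarith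
    rw [e1, e2, hres1, hres2, e3, show E + 2 = (E + 1) + 1 by ring, zpow_add_one₀ hp' (E + 1)]
    ring
  have hsplit' : classV b p x - (-(p : ℚ)) ^ E * g * (vHat b p x - (p : ℚ) * φ * vHat2 b p x + (p : ℚ) ^ 2 * cc * vHat3 b p x) =
      ∑ s ∈ classSet b p x, ∑ o ∈ range 6, (A s o - Cr s o) := by
    rw [hsplit]
    have : ∑ s ∈ classSet b p x, ∑ o ∈ range 6, (A s o - Cr s o) =
        (∑ s ∈ classSet b p x, ∑ o ∈ range 6, A s o) - ∑ s ∈ classSet b p x, ∑ o ∈ range 6, Cr s o := by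
      rw [← sum_sub_distrib]; refine sum_congr rfl fun s _ => sum_sub_distrib _ _
    rw [this, hCsum, sub_zero]
  -- common norms
  have hpowE : padicNorm p ((-(p : ℚ)) ^ E) = (p : ℚ) ^ (-E) := by
    rw [padicNorm.eq_zpow_of_nonzero (zpow_ne_zero _ hp'), padicValRat.zpow, padicValRat.neg,
      padicValRat.self hprime.one_lt, mul_one]
  have hgx1 : padicNorm p g ≤ 1 := (padicNorm_gHat_class b hb hp5 hx hxmem hxmem).1
  have hφ1 : padicNorm p φ ≤ 1 := padicNorm_phiHat_le_one b hp2 x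
  have hHx1 : padicNorm p Hx ≤ 1 := padicNorm_harm_le_one hx 1
  have hHx21 : padicNorm p Hx2 ≤ 1 := padicNorm_harm_le_one hx 2
  -- termwise bound `p^{-(E+3)}`
  have hterm : ∀ s ∈ classSet b p x, ∀ o ∈ range 6, padicNorm p (A s o - Cr s o) ≤ (p : ℚ) ^ (-(E + 3)) := by
    intro s hs o ho
    have hsn : s ≤ (b 0).toNat := ((mem_classSet_iff b x s).1 hs).1
    have hsx : s % p = x := by rw [(mem_filter.1 hs).2, Nat.mod_eq_of_lt hx]
    have ho' := mem_range.1 ho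
    have hEs : classExp b p s = E := classExp_eq_of_mem hs
    by_cases hord : (o : ℤ) + 1 ≤ -netExp b s
    · -- `s` is a pole of order ≥ σ = o + 1
      have hAs : A s o = pfData b o s * harm (o + 1) s - (-(p : ℚ)) ^ E * g *
          ((-1 : ℚ) ^ (o + 1) * classRho b p s (o + 1) * harm (o + 1) (s / p) - (p : ℚ) * φ *
            ((-1 : ℚ) ^ (o + 1) * (((s / p : ℕ) : ℚ) * classRho b p s (o + 1)
              + (if ((o + 1 : ℕ) : ℤ) + 1 ≤ -netExp b s then classRho b p s (o + 1 + 1) else 0)) * harm (o + 1) (s / p))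
            + (p : ℚ) ^ 2 * cc * ((-1 : ℚ) ^ (o + 1) * (((s / p : ℕ) : ℚ) ^ 2 * classRho b p s (o + 1)
              + (if ((o + 1 : ℕ) : ℤ) + 1 ≤ -netExp b s then 2 * ((s / p : ℕ) : ℚ) * classRho b p s (o + 1 + 1) else 0)
              + (if ((o + 1 : ℕ) : ℤ) + 2 ≤ -netExp b s then classRho b p s (o + 1 + 2) else 0)) * harm (o + 1) (s / p))) := by
        simp only [hA, hF1, hF2, hF3, if_pos hord]
      have hρ'2 : (if ((o + 1 : ℕ) : ℤ) + 1 ≤ -netExp b s then 2 * ((s / p : ℕ) : ℚ) * classRho b p s (o + 1 + 1) else 0)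
          = 2 * ((s / p : ℕ) : ℚ) * (if ((o + 1 : ℕ) : ℤ) + 1 ≤ -netExp b s then classRho b p s (o + 1 + 1) else 0) := by
        split_ifs <;> ring
      rw [hρ'2] at hAs
      set σ := o + 1 with hσ
      set c := pfData b o s with hc
      set gs := gHat b p s with hgs
      set φs := phiHat b p s with hφs
      set cs := curvHat b p s with hcs
      set ρ := classRho b p s σ with hρdef
      set ρ' : ℚ := if (σ : ℤ) + 1 ≤ -netExp b s then classRho b p s (σ + 1) else 0 with hρ'
      set ρ'' : ℚ := if (σ : ℤ) + 2 ≤ -netExp b s then classRho b p s (σ + 2) else 0 with hρ''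
      set Hs := harm σ s with hHs
      set Hl := harm σ (s / p) with hHl
      set ℓ : ℚ := ((s / p : ℕ) : ℚ) with hℓ
      set N := Hs - Hl / (p : ℚ) ^ σ with hN
      -- ingredients
      have hD : padicNorm p (c - (-(p : ℚ)) ^ ((σ : ℤ) + E) * gs * (ρ - (p : ℚ) * φs * ρ' + (p : ℚ) ^ 2 * cs * ρ'')) ≤
          (p : ℚ) ^ (-((σ : ℤ) + E + 3)) := by
        have h := leadingDigit₃ b hb hp5 hwin hsn (σ := σ) (by omega) (by omega)
        rw [hEs, show σ - 1 = o by omega] at h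
        exact h
      have hcA : padicNorm p c ≤ (p : ℚ) ^ (-((σ : ℤ) + E)) := by
        refine padicNorm_le_of_val fun hne' => ?_
        have := clusterBound_holds b p s o hb hprime (by omega) hwin hsn ho' hne'
        rw [hEs] at this; push_cast [hσ]; linarith
      have hρn : padicNorm p ρ ≤ 1 := padicNorm_classRho_le_one b h0 hsn hn hp2 σ
      have hρ'n : padicNorm p ρ' ≤ 1 := by
        rw [hρ']; split_ifs
        · exact padicNorm_classRho_le_one b h0 hsn hn hp2 (σ + 1)
        · simp
      have hρ''n : padicNorm p ρ'' ≤ 1 := by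
        rw [hρ'']; split_ifs
        · exact padicNorm_classRho_le_one b h0 hsn hn hp2 (σ + 2)
        · simp
      have hgs1 : padicNorm p gs ≤ 1 := (padicNorm_gHat_class b hb hp5 hx hs hxmem).1
      have hgg : padicNorm p (gs - g) ≤ (p : ℚ) ^ (-(1 : ℤ)) := (padicNorm_gHat_class b hb hp5 hx hs hxmem).2
      have hφs1 : padicNorm p φs ≤ 1 := padicNorm_phiHat_le_one b hp2 s
      have hφφ : padicNorm p (φs - φ) ≤ (p : ℚ) ^ (-(1 : ℤ)) := padicNorm_phiHat_sub_le b hp2 hs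
      have hg2 : padicNorm p (gs - g * (1 - ℓ * p * φ)) ≤ (p : ℚ) ^ (-(2 : ℤ)) := padicNorm_gHat_sub_second_le b hp2 hx hs
      have hlp : s / p < p := Nat.div_lt_of_lt_mul (by nlinarith [hsn, hn])
      have hHl1 : padicNorm p Hl ≤ 1 := padicNorm_harm_le_one hlp σ
      have hN1 : padicNorm p N ≤ 1 := padicNorm_harm_sub_level_le_one σ s
      have hℓn : padicNorm p ℓ ≤ 1 := by rw [hℓ]; simpa using padicNorm.of_nat (p := p) (s / p)
      have hΔ := thirdOrder_transport_bound b hb hp5 hx hs hρn hρ'n hρ''n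
      -- the algebra: A = cN + D·Hl/p^σ + (−1)^σ (−p)^E Hl Δ
      have hzpow : (-(p : ℚ)) ^ ((σ : ℤ) + E) = (-1 : ℚ) ^ σ * (p : ℚ) ^ σ * (-(p : ℚ)) ^ E := by
        rw [zpow_add₀ hp', zpow_natCast, neg_pow]
      have eA : A s o = c * N
          + (c - (-(p : ℚ)) ^ ((σ : ℤ) + E) * gs * (ρ - (p : ℚ) * φs * ρ' + (p : ℚ) ^ 2 * cs * ρ'')) / (p : ℚ) ^ σ * Hl
          + (-1 : ℚ) ^ σ * (-(p : ℚ)) ^ E * Hl * (gs * (ρ - (p : ℚ) * φs * ρ' + (p : ℚ) ^ 2 * cs * ρ'')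
              - g * (ρ - (p : ℚ) * φ * (ℓ * ρ + ρ') + (p : ℚ) ^ 2 * cc * (ℓ ^ 2 * ρ + 2 * ℓ * ρ' + ρ''))) := by
        rw [hAs, hN, hzpow]; field_simp; ring
      have hP2 : padicNorm p ((c - (-(p : ℚ)) ^ ((σ : ℤ) + E) * gs * (ρ - (p : ℚ) * φs * ρ' + (p : ℚ) ^ 2 * cs * ρ''))
          / (p : ℚ) ^ σ * Hl) ≤ (p : ℚ) ^ (-(E + 3)) := by
        rw [padicNorm.mul, padicNorm.div, padicNorm_p_pow]
        calc _ / ((p : ℚ) ^ σ)⁻¹ * padicNorm p Hl ≤ (p : ℚ) ^ (-((σ : ℤ) + E + 3)) / ((p : ℚ) ^ σ)⁻¹ * 1 :=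
              mul_le_mul (div_le_div_of_nonneg_right hD (by positivity)) hHl1 (padicNorm.nonneg _)
                (div_nonneg (zpow_p_nonneg _) (by positivity))
          _ = (p : ℚ) ^ (-(E + 3)) := by
              rw [mul_one, div_inv_eq_mul, ← zpow_natCast, ← zpow_add₀ hp0]; ring_nf
      have hP3 : padicNorm p ((-1 : ℚ) ^ σ * (-(p : ℚ)) ^ E * Hl * (gs * (ρ - (p : ℚ) * φs * ρ' + (p : ℚ) ^ 2 * cs * ρ'')
          - g * (ρ - (p : ℚ) * φ * (ℓ * ρ + ρ') + (p : ℚ) ^ 2 * cc * (ℓ ^ 2 * ρ + 2 * ℓ * ρ' + ρ'')))) ≤ (p : ℚ) ^ (-(E + 3)) := by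
        rw [padicNorm.mul, padicNorm.mul, padicNorm.mul, hpowE]
        have h1 : padicNorm p ((-1 : ℚ) ^ σ) = 1 := by rw [padicNorm_pow_eq, padicNorm.neg, padicNorm.one, one_pow]
        rw [h1, one_mul]
        calc (p : ℚ) ^ (-E) * padicNorm p Hl * _ ≤ (p : ℚ) ^ (-E) * 1 * (p : ℚ) ^ (-(3 : ℤ)) :=
              mul_le_mul (mul_le_mul_of_nonneg_left hHl1 (zpow_p_nonneg _)) hΔ (padicNorm.nonneg _)
                (mul_nonneg (zpow_p_nonneg _) zero_le_one)
          _ = (p : ℚ) ^ (-(E + 3)) := by rw [mul_one, ← zpow_add₀ hp0]; ring_nf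
      -- the harmonic part `cN` against the correction
      have hP1 : padicNorm p (c * N - Cr s o) ≤ (p : ℚ) ^ (-(E + 3)) := by
        by_cases ho0 : o = 0
        · -- σ = 1
          have hσ1 : σ = 1 := by omega
          have hneg : netExp b s < 0 := by omega
          have hρ'e : ρ' = (if netExp b s ≤ -2 then classRho b p s 2 else 0) := by
            rw [hρ', hσ1]
            by_cases h2 : netExp b s ≤ -2
            · rw [if_pos (by omega), if_pos h2]
            · rw [if_neg (by omega), if_neg h2]
          have hCrs : Cr s o = (-(p : ℚ)) ^ (E + 1) * g *
              (Hx * ρ - (p : ℚ) * φ * Hx * (ℓ * ρ + ρ') - (p : ℚ) * Hx2 * ℓ * ρ) := by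
            simp only [hCr, ho0, hneg, and_self, if_true, zero_ne_one, false_and, if_false, add_zero, hρdef, hσ1, hρ'e, hℓ]
          -- Theorem B to second order at σ = 1
          have hB : padicNorm p (c - (-(p : ℚ)) ^ (E + 1) * gs * (ρ - (p : ℚ) * φs * ρ')) ≤ (p : ℚ) ^ (-(E + 3)) := by
            have h := leadingDigit₂ b hb hp5 hwin hsn (σ := 1) le_rfl (by omega)
            have e4 : (if ((1 : ℕ) : ℤ) + 1 ≤ -netExp b s then classRho b p s (1 + 1) else 0) = ρ' := by rw [hρ', hσ1]
            have e5 : classRho b p s 1 = ρ := by rw [hρdef, hσ1]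
            rw [e4, e5, hEs, show (1 : ℕ) - 1 = o by omega, show ((1 : ℕ) : ℤ) + E = E + 1 by ring] at h
            rw [show -(E + 3) = -(E + 1 + 2) by ring]
            exact h
          have hνN : padicNorm p (N - (Hx - ℓ * p * Hx2)) ≤ (p : ℚ) ^ (-(2 : ℤ)) := by
            have h := padicNorm_harmN1_sub_le₂ (p := p) hp5 s
            rw [hsx] at h
            rw [hN, hHs, hHl, hσ1, hHx, hHx2, hℓ]
            exact h
          rw [hCrs]
          exact corrOne_bound hB hN1 hνN hg2 hφφ hgs1 hgx1 hρn hρ'n hHx1 hHx21 hφ1 hφs1 hℓn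
        · by_cases ho1 : o = 1
          · -- σ = 2
            have hσ2 : σ = 2 := by omega
            have hn2 : netExp b s ≤ -2 := by omega
            have hCrs : Cr s o = (-(p : ℚ)) ^ (E + 2) * g * Hx2 * ρ := by
              simp only [hCr, ho1, hn2, and_self, if_true, one_ne_zero, false_and, if_false, zero_add, hρdef, hσ2]
            -- Theorem B to first order at σ = 2
            have hB : padicNorm p (c - (-(p : ℚ)) ^ (E + 2) * gs * ρ) ≤ (p : ℚ) ^ (-(E + 3)) := by
              refine padicNorm_le_of_val fun hne' => ?_
              have := leadingDigit_holds b p s 2 hb hprime hp5 hwin hsn (by norm_num) (by omega)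
                (by rw [hEs, show ((2 : ℕ) : ℤ) + E = E + 2 by ring, show 2 - 1 = o by omega, ← hσ2]; exact hne')
              rw [hEs, show ((2 : ℕ) : ℤ) + E = E + 2 by ring, show 2 - 1 = o by omega, ← hσ2] at this
              linarith
            have hNH : padicNorm p (N - Hx2) ≤ (p : ℚ) ^ (-(1 : ℤ)) := by
              have h := padicNorm_harmN2_sub_le (p := p) hp5 s
              rw [hsx] at h
              rw [hN, hHs, hHl, hσ2, hHx2]
              exact h
            rw [hCrs]
            exact corrTwo_bound hB hN1 hρn hgx1 hgg hNH
          · -- σ ≥ 3: no correction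
            have hCrs : Cr s o = 0 := by simp only [hCr, ho0, ho1, false_and, if_false, add_zero]
            rw [hCrs, sub_zero, padicNorm.mul]
            calc padicNorm p c * padicNorm p N ≤ (p : ℚ) ^ (-((σ : ℤ) + E)) * 1 :=
                  mul_le_mul hcA hN1 (padicNorm.nonneg _) (zpow_p_nonneg _)
              _ ≤ (p : ℚ) ^ (-(E + 3)) := by rw [mul_one]; exact zpow_le_zpow_right₀ one_le_p (by omega)
      have e2 : A s o - Cr s o = (c * N - Cr s o)
          + (c - (-(p : ℚ)) ^ ((σ : ℤ) + E) * gs * (ρ - (p : ℚ) * φs * ρ' + (p : ℚ) ^ 2 * cs * ρ'')) / (p : ℚ) ^ σ * Hl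
          + (-1 : ℚ) ^ σ * (-(p : ℚ)) ^ E * Hl * (gs * (ρ - (p : ℚ) * φs * ρ' + (p : ℚ) ^ 2 * cs * ρ'')
              - g * (ρ - (p : ℚ) * φ * (ℓ * ρ + ρ') + (p : ℚ) ^ 2 * cc * (ℓ ^ 2 * ρ + 2 * ℓ * ρ' + ρ''))) := by
        rw [eA]; ring
      rw [e2]
      exact (padicNorm.nonarchimedean (p := p)).trans
        (max_le ((padicNorm.nonarchimedean (p := p)).trans (max_le hP1 hP2)) hP3)
    · -- no pole of order ≥ o + 1 at `s`: everything vanishes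
      have hAs : A s o = 0 := by
        simp only [hA, if_neg hord]
        rw [pfData_eq_zero_of_order_le b hb hsn ho' (by omega)]; ring
      have hCrs : Cr s o = 0 := by
        have hno : ¬ (o = 0 ∧ netExp b s < 0) := by
          rintro ⟨rfl, hneg⟩
          exact hord (by push_cast; omega)
        have hno1 : ¬ (o = 1 ∧ netExp b s ≤ -2) := by
          rintro ⟨rfl, hneg⟩
          exact hord (by push_cast; omega)
        simp only [hCr, hno, hno1, if_false, add_zero]
      rw [hAs, hCrs, sub_zero, padicNorm.zero]; exact zpow_p_nonneg _
  apply val_ge_of_padicNorm_le hne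
  rw [hsplit']
  exact padicNorm.sum_le' (fun s hs => padicNorm.sum_le' (fun o ho => hterm s hs o ho) (zpow_p_nonneg _)) (zpow_p_nonneg _)

end Summit.KontsevichZagierPeriods.Zeta5Search.SecondOrder

end
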